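import Literature.NumberTheory.EllipticCurves.BSDSelmerPConverseRamifiedProofs
import Literature.NumberTheory.EllipticCurves.BSDSelmerParityProofs
import Literature.NumberTheory.EllipticCurves.PAdicBSDKatoFiniteProofs
import HarnessLib

/-!
# Thm. 1.10 of Burungale–Skinner–Tian–Wan over the common leaf set of the bsd.S19/S25 cluster

Family `bsd`, companion to `Literature.NumberTheory.EllipticCurves.BSDSelmer` (bsd.S25) and to the
assemblies `BSDSelmerPConverseProofs` / `BSDSelmerPConverseRamifiedProofs` of the verbatim named fact
`burungaleSkinnerTianWan_analyticRank_eq_one_of_selmerCorank_eq_one` (A. Burungale, C. Skinner,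
Y. Tian, X. Wan, *Zeta elements for elliptic curves and applications*, arXiv:2409.01350,
**Thm. 1.10**, p. 5).

`burungaleSkinnerTianWan_analyticRank_eq_one_of_selmerCorank_eq_one_of_leaves`
(`BSDSelmerPConverseRamifiedProofs`) derives Thm. 1.10 from five named facts: (a) the `p`-parity
theorem `p_parity W p` **for every elliptic `W/ℚ` and every prime `p`** (Dokchitser–Dokchitser
2010, Thm. 1.4, whose printed proof at `p = 2` is Monsky's theorem), (b) the Friedberg–Hoffstein
field, (c) Kato's finiteness theorem `kato_finite_of_L_one_ne_zero W p` for all `W, p`, (e) the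
`p`-converse over the auxiliary imaginary quadratic field, (f) `hasEntireLFunction_rat`.

This file re-assembles Thm. 1.10 over the leaf set that the tree ALREADY uses for (a), (c), (f),
so that the fact rests on fewer, shared, named inputs:

* `analyticRank_eq_one_of_selmerCorank_eq_one_of_rootNumber_eq_neg_one` — the core of the printed
  proof (proof of Thm. 12.3, p. 96, "Proceeding as in" for Thm. 12.11, p. 98 — Part II, §12 of
  arXiv:2409.01350v2; "Thm. 4.3, p. 82 / Thm. 4.11, p. 84" of the held TeX-derived text, see the
  locator erratum under References) from the line
  "`ε(A_g) = -1`" onwards, with the sign `w(E) = -1` as an explicit hypothesis on the curve in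
  hand instead of the parity theorem for all curves and primes: steps (b) Friedberg–Hoffstein,
  (c) Kato, (d) `selmerCorank_baseChange_quadratic` (a tree theorem), (e), (f).
* `rootNumber_eq_neg_one_of_selmerCorank_eq_one_of_facts` — the first line of the printed proof
  ("Since `corank Sel = 1`, note that `ε(A_g) = -1` by the proof of parity conjecture [N1]",
  p. 96) for the ODD prime `p` of Thm. 1.10, through the tree's reduction of the `p`-parity
  theorem for odd `p` (`selmerCorank_mod_two_eq_of_ne_two_of_facts`, Dokchitser–Dokchitser 2010,
  §4.6: Waldspurger, Murty–Murty (Remark 1), Gross–Zagier–Kolyvagin, the Selmer rank of a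
  quadratic base change (theorem), `rk_p(E/M₀)` odd) and the parity of the analytic rank from the
  Modularity Theorem (`p_parity_of_selmerCorank_mod_two_eq_of_exists_isNewformOf`). Monsky's
  theorem (`p = 2`) is not needed: Thm. 1.10 has `p ∤ 2N`.
* `burungaleSkinnerTianWan_analyticRank_eq_one_of_selmerCorank_eq_one_of_exists_isNewformOf` —
  **Thm. 1.10 exactly as printed from**: the Modularity Theorem
  `ModularForms.exists_isNewformOf` (which gives (f) by `hasEntireLFunction_rat_of_exists_isNewformOf`
  and the parity of the analytic rank), `waldspurger_exists_heegnerField_twist_ne_zero`,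
  `murtyMurty_exists_heegnerField_twist_simpleZero_of_rootNumber_eq_one`,
  `rank_eq_analyticRank_of_analyticRank_le_one` (Gross–Zagier–Kolyvagin, which also gives (c) by
  the tree theorem `kato_finite_of_L_one_ne_zero_of_rank_eq_analyticRank`),
  `dokchitser_selmerCorank_baseChange_mod_two_eq`, (b)
  `friedbergHoffstein_exists_heegnerField_split_twist_ne_zero` and (e)
  `burungaleSkinnerTianWan_analyticRankEK_eq_one_of_selmerCorank_eq_one`; (sur_ℚ) ⟹ (sur) for
  every `p` is the tree theorem
  `hasSurjectiveModNGaloisRep_pow_of_hasMultiplicativeReductionAtPrime`. Compared with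
  `…_of_leaves`, the inputs `p_parity` (all `p`, hence Monsky), `kato_finite_of_L_one_ne_zero`
  and `hasEntireLFunction_rat` are replaced by named facts on which the tree's own reductions of
  those three already rest; no input is new, none is discharged here.
* `analyticRank_eq_one_of_selmerCorank_eq_one_of_exists_isNewformOf` — the interim bsd.S25
  statement from the same inputs.

Nothing is asserted: every input is a hypothesis (D-0014); no new named fact is introduced.

## References

* [BurungaleSkinnerTianWan2024] A. Burungale, C. Skinner, Y. Tian, X. Wan, *Zeta elements for
  elliptic curves and applications*, arXiv:2409.01350v2 (2024), PRINTED numbering and arXiv v2 PDF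
  pages: Thm. 1.10 (p. 5); §12: proof of Thm. 12.3 (p. 96, lines "ε(A_g) = -1 by the proof of
  parity conjecture [106]" ([106] = Nekovář, [N1] of the TeX), "The existence of L is a special case
  of the main result of [51]" ([FH]), "As L(1,g') ≠ 0, the Selmer group … is finite (cf. [79,
  Thm. 14.2])" ([K]), the splitting of `Sel(A_{g/L})`), Thm. 12.11 (p. 98, "Proceeding as in the
  proof of Theorem 12.3"). LOCATOR ERRATUM (2026-08-25, checked against the arXiv v2 PDF): earlier
  revisions of this file gave these as "Part II §4: proof of Thm. 4.3 (p. 82), Thm. 4.11 (p. 84)" —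
  the numbering of the held TeX-derived text (`lit read arxiv:2409.01350`), whose "p. N" are chunk
  indices and whose extraction restarts the section counter inside Part II (held §s = printed
  §(s+8)); the paper numbers §1–§12 continuously; the quoted words are unchanged.
* [Nekovar2006] J. Nekovář, *Selmer complexes*, Astérisque 310 (2006) (the parity input [N1] of
  the source; here replaced by the tree's Dokchitser–Dokchitser reduction for odd `p`).
* [DokchitserDokchitserAnnals2010] T. Dokchitser, V. Dokchitser, Ann. of Math. 172 (2010),
  Thm. 1.4 and §4.6 (proof of Thm. 4.19).
* [BCDTJAMS2001] C. Breuil, B. Conrad, F. Diamond, R. Taylor, JAMS 14 (2001), Thm. A.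
* [Kato2004Asterisque] K. Kato, Astérisque 295 (2004), Thm. 14.2; [Darmon2004] H. Darmon, CBMS 101
  (2004), Thm. 3.22 (Gross–Zagier–Kolyvagin).
-/

noncomputable section

open scoped Classical

open WeierstrassCurve

namespace Literature.NumberTheory.EllipticCurves

/-! ### The core of the printed proof from "`ε(A_g) = -1`" onwards -/

/-- **Proof of Thm. 12.3 / Thm. 12.11 (Part II) of Burungale–Skinner–Tian–Wan for an elliptic curve,
from the sign onwards** (arXiv:2409.01350v2, p. 96: "Let `L` be an imaginary quadratic field
satisfying (ord), (coprime) and (Heeg) so that `ord_{s=1} L(s, g/L) = ord_{s=1} L(s, g)`. The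
existence of `L` is a special case of the main result of [FH]. As `L(1, g') ≠ 0`, the Selmer
group `Sel_{λ^∞}(A_{g'})` is finite (cf. [K]). In view of the splitting
`Sel_{λ^∞}(A_{g/L}) ≃ Sel_{λ^∞}(A_g) ⊕ Sel_{λ^∞}(A_{g'})` it follows that
`corank Sel_{λ^∞}(A_{g/L}) = 1` […]", then the `p`-converse over `L`; p. 98: "Proceeding as in
the proof of Theorem 12.3, we deduce the following. Theorem 12.11"). Same statement and proof as
`analyticRank_eq_one_of_selmerCorank_eq_one_of_padicSurjective` (`BSDSelmerPConverseProofs`)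
except that the sign `w(E) = -1` of the curve in hand is the hypothesis `hw` (there it is derived
from the `p`-parity theorem for all curves and primes). Inputs: (b) the Friedberg–Hoffstein field
(`hFH`), (c) Kato's finiteness theorem (`hKato`), (d) Selmer coranks under quadratic base change
(`hbc`, the tree theorem `selmerCorank_baseChange_quadratic_holds` may be supplied), (e) the
`p`-converse over the auxiliary field (`hL`), (f) the entire continuation (`hE`, through
`analyticRankEK_eq_add_of`). [cite: BurungaleSkinnerTianWan2024, proof of Thm. 12.3 (p. 96) and Thm. 12.11 (p. 98)] -/
theorem analyticRank_eq_one_of_selmerCorank_eq_one_of_rootNumber_eq_neg_one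
    (hFH : friedbergHoffstein_exists_heegnerField_split_twist_ne_zero)
    (hKato : ∀ (W : WeierstrassCurve ℚ) [W.IsElliptic] (p : ℕ) [Fact p.Prime],
      kato_finite_of_L_one_ne_zero W p)
    (hbc : selmerCorank_baseChange_quadratic)
    (hL : burungaleSkinnerTianWan_analyticRankEK_eq_one_of_selmerCorank_eq_one)
    (hE : hasEntireLFunction_rat)
    (W : WeierstrassCurve ℚ) [W.IsElliptic] [W.IsGloballyMinimal] (p : ℕ) [Fact p.Prime]
    (hp : p ≠ 2) (hgood : W.HasGoodReductionAtPrime p) (hord : ¬ (p : ℤ) ∣ W.frobeniusTrace p)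
    (hsur : ∀ n : ℕ, W.HasSurjectiveModNGaloisRep (p ^ n : ℕ))
    (hram : ∃ ℓ : ℕ, ∃ _ : Fact ℓ.Prime, ℓ ≠ p ∧ W.HasMultiplicativeReductionAtPrime ℓ ∧
      ¬ p ∣ padicValInt ℓ W.minimalDiscriminantInt)
    (hw : W.rootNumber = -1) (hcorank : W.selmerCorank p = 1) :
    W.analyticRank = 1 := by
  -- (b) the auxiliary imaginary quadratic field
  obtain ⟨K, _, _, hK, -, hHN, hHp, hL1⟩ := hFH W hw p (Fact.out : p.Prime) 0
  -- (c) Kato: the `p^∞`-Selmer group of the twist is finite, hence of corank `0`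
  have hd : (NumberField.discr K : ℚ) ≠ 0 := by exact_mod_cast NumberField.discr_ne_zero K
  haveI := W.isElliptic_quadraticTwist hd
  obtain ⟨-, -, hfin⟩ := hKato (W.quadraticTwist (NumberField.discr K : ℚ)) p hL1
  haveI := hfin
  have h0 : (W.quadraticTwist (NumberField.discr K : ℚ)).selmerCorank p = 0 :=
    (W.quadraticTwist (NumberField.discr K : ℚ)).selmerCorank_eq_zero_of_finite p
  -- (d) the corank over `K` is `1`
  have hK1 : (W.baseChange K).selmerCorank p = 1 := by
    rw [hbc W K hK.1 p, hcorank, h0]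
  -- (e) the `p`-converse over `K`
  have hEK : analyticRankEK W K = 1 := hL W p hp hgood hord hsur hram K hK hHN hHp hK1
  -- (f) factorisation of the analytic rank over `K`
  rw [analyticRankEK_eq_add_of hE W K, analyticRank_eq_zero_of_entireLFunction_one_ne_zero _ hL1,
    add_zero] at hEK
  exact hEK

/-! ### The first line of the printed proof: the sign is `-1`, for the odd prime of Thm. 1.10 -/

/-- **"Since `corank_{𝒪_λ} Sel_{λ^∞}(A_g) = 1`, note that `ε(A_g) = -1` by the proof of parity
conjecture [N1]"** (Burungale–Skinner–Tian–Wan, arXiv:2409.01350v2, proof of Thm. 12.3,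
p. 96, first line; [N1] = Nekovář, *Selmer complexes*, Astérisque 310), for an elliptic curve
`E/ℚ` and an ODD prime `p` — all that Thm. 1.10 (`p ∤ 2N`) uses. In the tree the parity input for
odd `p` is the reduction of Dokchitser–Dokchitser 2010, Thm. 4.19, §4.6
(`selmerCorank_mod_two_eq_of_ne_two_of_facts`: the entire continuation, Waldspurger `hWa`,
Murty–Murty with Remark 1 `hMM`, Gross–Zagier–Kolyvagin `hGZK`, the Selmer rank of a quadratic
base change — the theorem `selmerCorank_baseChange_quadratic_holds` —, and `rk_p(E/M₀)` odd
`hDD`), and the passage `corank ≡ ord (mod 2)` ⟹ `(-1)^{corank} = w(E)` is the parity of the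
analytic rank from the Modularity Theorem `hmod`
(`p_parity_of_selmerCorank_mod_two_eq_of_exists_isNewformOf`; `hmod` also supplies the entire
continuation, `hasEntireLFunction_rat_of_exists_isNewformOf`). Monsky's theorem (`p = 2`) does
not enter. [cite: BurungaleSkinnerTianWan2024, proof of Thm. 12.3 (p. 96, first line)] [cite: DokchitserDokchitserAnnals2010, Thm. 1.4 and §4.6 (proof of Thm. 4.19)] -/
theorem rootNumber_eq_neg_one_of_selmerCorank_eq_one_of_facts
    (hmod : ModularForms.exists_isNewformOf)
    (hWa : waldspurger_exists_heegnerField_twist_ne_zero)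
    (hMM : murtyMurty_exists_heegnerField_twist_simpleZero_of_rootNumber_eq_one)
    (hGZK : rank_eq_analyticRank_of_analyticRank_le_one)
    (hDD : dokchitser_selmerCorank_baseChange_mod_two_eq)
    (W : WeierstrassCurve ℚ) [W.IsElliptic] (p : ℕ) [Fact p.Prime] (hp : p ≠ 2)
    (hcorank : W.selmerCorank p = 1) : W.rootNumber = -1 := by
  have hpar : p_parity W p :=
    p_parity_of_selmerCorank_mod_two_eq_of_exists_isNewformOf W p hmod
      (selmerCorank_mod_two_eq_of_ne_two_of_facts (hasEntireLFunction_rat_of_exists_isNewformOf hmod)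
        hWa hMM hGZK selmerCorank_baseChange_quadratic_holds hDD W p hp
        (even_analyticRank_iff_rootNumber_eq_one_of_exists_isNewformOf W hmod))
  unfold p_parity at hpar
  rw [hcorank, pow_one] at hpar
  exact hpar.symm

/-! ### Thm. 1.10 over the common leaf set -/

/-- **Burungale–Skinner–Tian–Wan, arXiv:2409.01350, Thm. 1.10 exactly as printed** ("Let `E/ℚ` be
an elliptic curve of conductor `N`, and `p ∤ 2N` an ordinary prime. Suppose that […] (sur_ℚ) The
mod `p` Galois representation `ρ̄ : G_ℚ → Aut_{𝔽_p} E[p]` is surjective. (ram) There exists a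
prime `ℓ ‖ N` such that `ρ̄` is ramified at `ℓ`. Then
`corank_{ℤ_p} Sel_{p^∞}(E/ℚ) = 1 ⟹ ord_{s=1} L(s, E/ℚ) = 1`", p. 5; the tree's
named fact `burungaleSkinnerTianWan_analyticRank_eq_one_of_selmerCorank_eq_one`) **from the common
leaf set**: the Modularity Theorem `hmod` (`ModularForms.exists_isNewformOf`, BCDT 2001, Thm. A:
entire continuation (f) and parity of the analytic rank), Waldspurger `hWa`, Murty–Murty
(Remark 1) `hMM`, Gross–Zagier–Kolyvagin `hGZK` (`rank_eq_analyticRank_of_analyticRank_le_one`,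
which also yields (c) Kato's finiteness theorem by
`kato_finite_of_L_one_ne_zero_of_rank_eq_analyticRank`), `rk_p(E/M₀)` odd `hDD` — these four and
`hmod` give the sign (a) for the odd prime `p`
(`rootNumber_eq_neg_one_of_selmerCorank_eq_one_of_facts`) —, (b) the Friedberg–Hoffstein field
`hFH` and (e) the `p`-converse over the auxiliary field `hL`; (d) is the theorem
`selmerCorank_baseChange_quadratic_holds` and (sur_ℚ) + (ram) ⟹ (sur) for every `p` the theorem
`hasSurjectiveModNGaloisRep_pow_of_hasMultiplicativeReductionAtPrime`. Then the core
`analyticRank_eq_one_of_selmerCorank_eq_one_of_rootNumber_eq_neg_one` applies.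
[cite: BurungaleSkinnerTianWan2024, Thm. 1.10 (p. 5) and proof of Thm. 12.3 (p. 96), Thm. 12.11 (p. 98)] -/
theorem burungaleSkinnerTianWan_analyticRank_eq_one_of_selmerCorank_eq_one_of_exists_isNewformOf
    (hmod : ModularForms.exists_isNewformOf)
    (hWa : waldspurger_exists_heegnerField_twist_ne_zero)
    (hMM : murtyMurty_exists_heegnerField_twist_simpleZero_of_rootNumber_eq_one)
    (hGZK : rank_eq_analyticRank_of_analyticRank_le_one)
    (hDD : dokchitser_selmerCorank_baseChange_mod_two_eq)
    (hFH : friedbergHoffstein_exists_heegnerField_split_twist_ne_zero)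
    (hL : burungaleSkinnerTianWan_analyticRankEK_eq_one_of_selmerCorank_eq_one) :
    burungaleSkinnerTianWan_analyticRank_eq_one_of_selmerCorank_eq_one := by
  intro W _ _ p _ hp2 hgood hord hsurj hram hcorank
  exact analyticRank_eq_one_of_selmerCorank_eq_one_of_rootNumber_eq_neg_one hFH
    (fun W _ p _ ↦ kato_finite_of_L_one_ne_zero_of_rank_eq_analyticRank W p hGZK)
    selmerCorank_baseChange_quadratic_holds hL (hasEntireLFunction_rat_of_exists_isNewformOf hmod)
    W p hp2 hgood hord
    (hasSurjectiveModNGaloisRep_pow_of_hasMultiplicativeReductionAtPrime W p hsurj hram) hram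
    (rootNumber_eq_neg_one_of_selmerCorank_eq_one_of_facts hmod hWa hMM hGZK hDD W p hp2 hcorank)
    hcorank

/-- The interim bsd.S25 statement `analyticRank_eq_one_of_selmerCorank_eq_one` from the same
common leaf set (via `analyticRank_eq_one_of_selmerCorank_eq_one_of_bstw`).
[cite: BurungaleSkinnerTianWan2024, Thm. 1.10] -/
theorem analyticRank_eq_one_of_selmerCorank_eq_one_of_exists_isNewformOf
    (hmod : ModularForms.exists_isNewformOf)
    (hWa : waldspurger_exists_heegnerField_twist_ne_zero)
    (hMM : murtyMurty_exists_heegnerField_twist_simpleZero_of_rootNumber_eq_one)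
    (hGZK : rank_eq_analyticRank_of_analyticRank_le_one)
    (hDD : dokchitser_selmerCorank_baseChange_mod_two_eq)
    (hFH : friedbergHoffstein_exists_heegnerField_split_twist_ne_zero)
    (hL : burungaleSkinnerTianWan_analyticRankEK_eq_one_of_selmerCorank_eq_one) :
    analyticRank_eq_one_of_selmerCorank_eq_one :=
  analyticRank_eq_one_of_selmerCorank_eq_one_of_bstw
    (burungaleSkinnerTianWan_analyticRank_eq_one_of_selmerCorank_eq_one_of_exists_isNewformOf hmod
      hWa hMM hGZK hDD hFH hL)

end Literature.NumberTheory.EllipticCurves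

end
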